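import Summits.RiemannHypothesis.RiemannHypothesis.Theorems.HandoffWallSequence
import HarnessLib

/-!
# C-I(a) companion — FIRST-GAP LOCALITY AS AN UNCONDITIONAL DICHOTOMY: within a threshold class, C-I(a) is a property of the CLASS (RH-FREE)

RH-FREE (LADDER-RH column WEIL, PROOF-OF-DATA target (P2) C-I(a); cell `rh-explicit`, D-0040; typing lane cc-s2-1 gen19).  HONEST FRAMING:
statements about the tree's semi-local thresholds `a*(S) = weilSemilocalThreshold S` of TRUNCATED Weil forms; nothing here bears on RH.
No certificate is used: this is the certificate-free half of the class law, valid for EVERY finite `S` and EVERY prime `q`.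

The CLASS of a finite `S ⊆ ℕ` is its least missing prime `q` (`{p < q} ⊆ S ∌ q`).  theory-1's `weilSemilocalThreshold_eq_of_firstGap`
(`HandoffWallSequence` §4) says: the UPPER clause `UC(q) : a*(S_q) < (log q⁺)/2` at the class representative `S_q = Nat.primesBelow q`
forces `a*(S) = a*(S_q)`.  Here the hypothesis is moved from the representative to the class:

* §1 `min_weilSemilocalThreshold_eq_of_firstGap` ★ for every finite `S` of class `q`:
  `min (a*(S)) ((log q⁺)/2) = min (a*(S_q)) ((log q⁺)/2)` — below the window end of `q⁺` the two forms see the same prime powers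
  (`MotivicDoor.Semilocal.weilSemilocalPositivityOn_congr`), so the two thresholds agree OR both pass `(log q⁺)/2`; no third behaviour.
* §2 consequences: `weilSemilocalThreshold_lt_iff_of_firstGap` (`a*(S) < (log q⁺)/2 ↔ a*(S_q) < (log q⁺)/2`: the upper clause can be
  CERTIFIED ON ANY MEMBER of the class and then holds for all of them, with one common value `a*(S) = a*(S_q)`);
  `le_weilSemilocalThreshold_iff_of_firstGap` (the complementary event `(log q⁺)/2 ≤ a*(·)` is likewise class-wide);
  `weilSemilocalThreshold_eq_of_firstGap'` (UC certified on the member `S` ⇒ `a*(S') = a*(S)` for every `S'` of the same class).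

References: A. Connes, C. Consani, Enseign. Math. 69 (2023) §2.1.2 (`ConnesConsani2023`: only the primes `p < λ²` enter the semi-local form);
H. Yoshida, Adv. Stud. Pure Math. 21 (1992) Prop. 6 p. 320 (`Yoshida1992HermitianForms`: thresholds).  Folklore-level consequences of locality;
not in print as statements (cell files SEMILOCAL-TABLE.md §5, STRUCTURE.md §2 C-I).
-/

set_option linter.dupNamespace false  -- the mandated namespace repeats `RiemannHypothesis`

noncomputable section

open Set Literature.NumberTheory.LFunctions
open Summit.RiemannHypothesis.RiemannHypothesis.Theorems
open Summit.RiemannHypothesis.RiemannHypothesis.Theorems.HandoffDecomposition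
open Summit.RiemannHypothesis.RiemannHypothesis.Theorems.MotivicDoor.SemilocalThreshold
open Summit.RiemannHypothesis.RiemannHypothesis.Theorems.MotivicDoor.Semilocal (weilSemilocalPositivityOn_congr)

namespace Summit.RiemannHypothesis.RiemannHypothesis.Theorems.SemilocalClassLaw

variable {q : ℕ} {S S' : Finset ℕ}

/-! ## §1  The dichotomy -/

/-- The prime powers `n ≤ q⁺ − 1` are seen alike by `S` and by `S_q = {p < q}` whenever `{p < q} ⊆ S ∌ q`. [cite: ConnesConsani2023, §2.1.2] -/
theorem primeFactors_subset_iff_of_firstGap (hS : ∀ p < q, p.Prime → p ∈ S) (hqS : q ∉ S) :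
    ∀ n ≤ nextPrime q - 1, IsPrimePow n → (n.primeFactors ⊆ S ↔ n.primeFactors ⊆ Nat.primesBelow q) := by
  intro n hn hpp
  obtain ⟨p, k, hp, hk, rfl⟩ := (isPrimePow_nat_iff _).1 hpp
  rw [Nat.primeFactors_prime_pow hk.ne' hp, Finset.singleton_subset_iff, Finset.singleton_subset_iff, Nat.mem_primesBelow]
  have hple : p ≤ q := by
    by_contra hlt
    rw [not_le] at hlt
    have h2 := nextPrime_le hp hlt
    have h3 : p ≤ p ^ k := Nat.le_self_pow hk.ne' p
    omega
  rcases hple.eq_or_lt with rfl | hlt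
  · exact ⟨fun h ↦ absurd h hqS, fun h ↦ absurd h.1 (lt_irrefl _)⟩
  · exact ⟨fun _ ↦ ⟨hlt, hp⟩, fun _ ↦ hS p hlt hp⟩

/-- On every window `a ≤ (log q⁺)/2` the forms of `S` and of `S_q` are positive together (`{p < q} ⊆ S ∌ q`). [cite: ConnesConsani2023, §2.1.2] -/
theorem weilSemilocalPositivityOn_iff_of_firstGap (hS : ∀ p < q, p.Prime → p ∈ S) (hqS : q ∉ S) {a : ℝ}
    (ha : a ≤ Real.log (nextPrime q) / 2) :
    WeilSemilocalPositivityOn S a ↔ WeilSemilocalPositivityOn (Nat.primesBelow q) a := by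
  have h1 := (nextPrime_prime q).one_lt.le
  refine weilSemilocalPositivityOn_congr (primeFactors_subset_iff_of_firstGap hS hqS) ?_
  rwa [show ((nextPrime q - 1 : ℕ) : ℝ) + 1 = nextPrime q by exact_mod_cast Nat.sub_add_cancel h1]

/-- **THE DICHOTOMY (RH-free, every finite `S`, every class `q`)**: `min (a*(S)) ((log q⁺)/2) = min (a*(S_q)) ((log q⁺)/2)` —
the threshold of `S` and of its class representative agree, or both pass the window end of `q⁺`. [cite: ConnesConsani2023, §2.1.2; Yoshida1992HermitianForms, Prop. 6 (p. 320)] -/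
theorem min_weilSemilocalThreshold_eq_of_firstGap (hS : ∀ p < q, p.Prime → p ∈ S) (hqS : q ∉ S) :
    min (weilSemilocalThreshold S) (Real.log (nextPrime q) / 2) =
      min (weilSemilocalThreshold (Nat.primesBelow q)) (Real.log (nextPrime q) / 2) := by
  set L := Real.log (nextPrime q) / 2 with hL
  have key : ∀ {T T' : Finset ℕ}, (∀ a ≤ L, WeilSemilocalPositivityOn T a → WeilSemilocalPositivityOn T' a) →
      min (weilSemilocalThreshold T) L ≤ min (weilSemilocalThreshold T') L := fun {T T'} h ↦ by
    refine le_min ?_ (min_le_right _ _)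
    exact le_weilSemilocalThreshold
      (h _ (min_le_right _ _) ((weilSemilocalPositivityOn_weilSemilocalThreshold T).mono (min_le_left _ _)))
  exact le_antisymm (key fun a ha h ↦ (weilSemilocalPositivityOn_iff_of_firstGap hS hqS ha).1 h)
    (key fun a ha h ↦ (weilSemilocalPositivityOn_iff_of_firstGap hS hqS ha).2 h)

/-! ## §2  Consequences: the upper clause is a class property -/

/-- **`a*(S) < (log q⁺)/2 ↔ a*(S_q) < (log q⁺)/2`** for every `S` of class `q`: C-I(a) at `q` can be certified on ANY member of the class. [cite: ConnesConsani2023, §2.1.2] -/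
theorem weilSemilocalThreshold_lt_iff_of_firstGap (hS : ∀ p < q, p.Prime → p ∈ S) (hqS : q ∉ S) :
    weilSemilocalThreshold S < Real.log (nextPrime q) / 2 ↔
      weilSemilocalThreshold (Nat.primesBelow q) < Real.log (nextPrime q) / 2 := by
  have h := min_weilSemilocalThreshold_eq_of_firstGap hS hqS
  constructor <;> intro hlt
  · by_contra hge
    rw [not_lt] at hge
    rw [min_eq_left hlt.le, min_eq_right hge] at h
    exact absurd h hlt.ne
  · by_contra hge
    rw [not_lt] at hge
    rw [min_eq_right hge, min_eq_left hlt.le] at h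
    exact absurd h.symm hlt.ne

/-- The complementary event is class-wide too: `(log q⁺)/2 ≤ a*(S) ↔ (log q⁺)/2 ≤ a*(S_q)`. [cite: ConnesConsani2023, §2.1.2] -/
theorem le_weilSemilocalThreshold_iff_of_firstGap (hS : ∀ p < q, p.Prime → p ∈ S) (hqS : q ∉ S) :
    Real.log (nextPrime q) / 2 ≤ weilSemilocalThreshold S ↔
      Real.log (nextPrime q) / 2 ≤ weilSemilocalThreshold (Nat.primesBelow q) := by
  rw [← not_lt, ← not_lt, weilSemilocalThreshold_lt_iff_of_firstGap hS hqS]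

/-- UC certified on the MEMBER `S` (not on `S_q`) already gives `a*(S) = a*(S_q)`. [cite: ConnesConsani2023, §2.1.2] -/
theorem weilSemilocalThreshold_eq_of_lt_of_firstGap (hq : q.Prime) (hS : ∀ p < q, p.Prime → p ∈ S) (hqS : q ∉ S)
    (hlt : weilSemilocalThreshold S < Real.log (nextPrime q) / 2) :
    weilSemilocalThreshold S = weilSemilocalThreshold (Nat.primesBelow q) :=
  weilSemilocalThreshold_eq_of_firstGap hq hS hqS ((weilSemilocalThreshold_lt_iff_of_firstGap hS hqS).1 hlt)

/-- **One class, one threshold**: if `S` and `S'` have the same class `q` and UC is certified on `S`, then `a*(S') = a*(S)`. [cite: ConnesConsani2023, §2.1.2] -/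
theorem weilSemilocalThreshold_eq_of_firstGap' (hq : q.Prime) (hS : ∀ p < q, p.Prime → p ∈ S) (hqS : q ∉ S)
    (hS' : ∀ p < q, p.Prime → p ∈ S') (hqS' : q ∉ S') (hlt : weilSemilocalThreshold S < Real.log (nextPrime q) / 2) :
    weilSemilocalThreshold S' = weilSemilocalThreshold S := by
  have hq' := (weilSemilocalThreshold_lt_iff_of_firstGap hS hqS).1 hlt
  rw [weilSemilocalThreshold_eq_of_firstGap hq hS' hqS' hq', weilSemilocalThreshold_eq_of_firstGap hq hS hqS hq']

/-- Either way the thresholds of a class are TIED: `a*(S) = a*(S_q)`, or both are `≥ (log q⁺)/2` (RH-free trichotomy-free statement). [cite: ConnesConsani2023, §2.1.2] -/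
theorem weilSemilocalThreshold_eq_or_le_of_firstGap (hq : q.Prime) (hS : ∀ p < q, p.Prime → p ∈ S) (hqS : q ∉ S) :
    weilSemilocalThreshold S = weilSemilocalThreshold (Nat.primesBelow q) ∨
      (Real.log (nextPrime q) / 2 ≤ weilSemilocalThreshold S ∧
        Real.log (nextPrime q) / 2 ≤ weilSemilocalThreshold (Nat.primesBelow q)) := by
  by_cases h : weilSemilocalThreshold (Nat.primesBelow q) < Real.log (nextPrime q) / 2
  · exact Or.inl (weilSemilocalThreshold_eq_of_firstGap hq hS hqS h)
  · rw [not_lt] at h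
    exact Or.inr ⟨(le_weilSemilocalThreshold_iff_of_firstGap hS hqS).2 h, h⟩

end Summit.RiemannHypothesis.RiemannHypothesis.Theorems.SemilocalClassLaw

end
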